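import Literature.AlgebraicGeometry.Motives.ProjectiveSpaceFieldPointsBijective
import Literature.AlgebraicGeometry.Motives.TheoremOfCubeLimitProofs
import HarnessLib

/-!
# Ring-valued points of projective space from coordinate vectors

For a field `k`, a commutative `k`-algebra `S` and `n : ℕ`, a vector `v ∈ Sⁿ⁺¹` one of whose
coordinates (more generally: whose value under a homogeneous `t` of positive degree) is a **unit**
defines a `k`-morphism `Spec S → ℙⁿ_k` through the chart `D₊(t) = Spec k[x]_{(t)}`:
`g/tᵐ ↦ g(v)·t(v)⁻ᵐ` (Hartshorne II Thm. 7.1 for `X = Spec S` and the sections `vᵢ` of `𝒪_X`,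
or Görtz–Wedhorn I (13.8): `ℙⁿ(S) ⊇ {v ∈ Sⁿ⁺¹ with a unit coordinate}/Sˣ`). This file sets up
this dictionary, generalising `Motives/ProjectiveSpaceFieldPoints` from fields to rings:

* `Spec` of a `k`-algebra map over `Spec k` is the tree's `specOverOfAlgHom`
  (`Motives/TheoremOfCubeLimitProofs`; imported from there — one constant per notion — pending its
  relocation to a lighter home by the librarian); here: its functoriality `specOverOfAlgHom_comp`
  and the `rfl` bridge `AlgPoints.ofAlgHom_eq_specOverOfAlgHom` to the field-points API;
* `ProjectiveSpace.awayEvalU v hv : k[x]_{(t)} →ₐ[k] S` and `ProjectiveSpace.vecChartPoint`: the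
  `k`-morphism `specOver k S ⟶ projectiveSpace n k`; independence of the chart
  (`vecChartPoint_eq_vecChartPoint`), invariance under `v ↦ u • v` for `u ∈ Sˣ`
  (`vecChartPoint_smul`), **functoriality** in `S` (`specOverOfAlgHom_comp_vecChartPoint`: for a
  `k`-algebra map `ρ : S → S'`, `Spec ρ ≫ [v] = [ρ ∘ v]`), and agreement with the field version
  (`vecChartPoint_eq_chartPoint`).

The sequel `Motives/ProjectiveSpaceRingPointsRigidity` adds: the image lies in `V₊(G)` when
`G(v) = 0`, and rigidity over a domain (vectors with vanishing `2 × 2` minors give the same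
morphism). Together these are the tools for gluing morphisms into a projective hypersurface from
local vector data (e.g. the addition law of a plane cubic, Silverman *AEC* III.3.6).

## References

* R. Hartshorne, *Algebraic Geometry*, GTM 52 (1977): II Prop. 2.5, II Thm. 7.1. [Hartshorne1977]
* U. Görtz, T. Wedhorn, *Algebraic Geometry I*, 2nd ed. (2020): (13.8), p. 484. [GortzWedhorn2020]
-/

noncomputable section

open CategoryTheory AlgebraicGeometry HomogeneousLocalization MvPolynomial

universe u

namespace Literature.AlgebraicGeometry.Motives

/-! ### `Spec` of a `k`-algebra map as a morphism of `k`-schemes -/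

section SpecOverHom

variable {k : Type u} [CommRing k] {A B C : Type u} [CommRing A] [CommRing B] [CommRing C]
  [Algebra k A] [Algebra k B] [Algebra k C]

/-- `specOverOfAlgHom` (the tree's `Spec φ` over `Spec k`) is contravariantly functorial. [folklore] -/
theorem specOverOfAlgHom_comp (φ : A →ₐ[k] B) (ψ : B →ₐ[k] C) :
    specOverOfAlgHom (ψ.comp φ) = specOverOfAlgHom ψ ≫ specOverOfAlgHom φ := by
  ext : 1
  rw [Over.comp_left, specOverOfAlgHom_left, specOverOfAlgHom_left, specOverOfAlgHom_left,
    show (ψ.comp φ).toRingHom = ψ.toRingHom.comp φ.toRingHom from rfl, CommRingCat.ofHom_comp,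
    Spec.map_comp]
  rfl

/-- Bridge to the field-points API: the `L`-point `AlgPoints.ofAlgHom e` of `Spec R`
(`Transcendental/AnalytificationProjProofs`) *is* `specOverOfAlgHom e` (`rfl`). [folklore] -/
theorem AlgPoints.ofAlgHom_eq_specOverOfAlgHom {K : Type u} [Field K] {R L : Type u} [CommRing R]
    [Algebra K R] [Field L] [Algebra K L] (e : R →ₐ[K] L) :
    AlgPoints.ofAlgHom e = specOverOfAlgHom e :=
  rfl

end SpecOverHom

namespace ProjectiveSpace

variable {k : Type u} [Field k] {n : ℕ} {S : Type u} [CommRing S] [Algebra k S]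

attribute [local instance] MvPolynomial.gradedAlgebra ProjBaseChange.algebraBase

local notation "𝒜" => MvPolynomial.homogeneousSubmodule (Fin (n + 1)) k

/-! ### Evaluation at a vector with a unit value of `t` -/

section AwayEvalU

variable {t : MvPolynomial (Fin (n + 1)) k} {d : ℕ}

/-- Evaluation at `v` extended to `k[x]_t → S` when `t(v)` is a unit (Mathlib
`Localization.awayLift`). [folklore] -/
def awayEvalULoc (v : Fin (n + 1) → S) (hv : IsUnit (aeval v t)) : Localization.Away t →+* S :=
  Localization.awayLift (aeval v).toRingHom t hv

/-- `awayEvalULoc v hv (a/tʲ) = a(v) · (t(v)⁻¹)ʲ`. [folklore] -/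
theorem awayEvalULoc_mk (v : Fin (n + 1) → S) (hv : IsUnit (aeval v t))
    (a : MvPolynomial (Fin (n + 1)) k) (j : ℕ) :
    awayEvalULoc v hv (Localization.mk a ⟨t ^ j, j, rfl⟩) = aeval v a * (↑(hv.unit⁻¹) : S) ^ j :=
  Localization.awayLift_mk _ _ _ _ (by exact hv.mul_val_inv) _

/-- `awayEvalULoc` restricted to `k[x]` is evaluation at `v`. [folklore] -/
@[simp]
theorem awayEvalULoc_algebraMap (v : Fin (n + 1) → S) (hv : IsUnit (aeval v t))
    (a : MvPolynomial (Fin (n + 1)) k) :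
    awayEvalULoc v hv (algebraMap _ (Localization.Away t) a) = aeval v a := by
  rw [awayEvalULoc, Localization.awayLift, IsLocalization.Away.lift_eq]
  rfl

/-- **Evaluation at `v` on the degree-zero localization** `k[x]_{(t)} → S`, `g/tᵐ ↦ g(v)·t(v)⁻ᵐ`,
for `t(v)` a unit: the `S`-point of the chart `D₊(t)` with homogeneous coordinates `v`
(Hartshorne II Prop. 2.5, Thm. 7.1). [folklore] -/
def awayEvalU (v : Fin (n + 1) → S) (hv : IsUnit (aeval v t)) : Away 𝒜 t →ₐ[k] S where
  __ := (awayEvalULoc v hv).comp (algebraMap (Away 𝒜 t) (Localization.Away t))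
  commutes' c := by
    simp only [RingHom.toMonoidHom_eq_coe, OneHom.toFun_eq_coe, MonoidHom.toOneHom_coe,
      MonoidHom.coe_coe, RingHom.coe_comp, Function.comp_apply]
    rw [HomogeneousLocalization.algebraMap_apply, ProjBaseChange.val_algebraMap,
      IsScalarTower.algebraMap_apply k (MvPolynomial (Fin (n + 1)) k) (Localization.Away t),
      awayEvalULoc_algebraMap, MvPolynomial.algebraMap_eq, aeval_C]

/-- `awayEvalU` is `awayEvalULoc` on the underlying fraction (`rfl`). [folklore] -/
theorem awayEvalU_apply (v : Fin (n + 1) → S) (hv : IsUnit (aeval v t)) (q : Away 𝒜 t) :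
    awayEvalU v hv q = awayEvalULoc v hv q.val :=
  rfl

/-- `awayEvalU v hv (g/tᵐ) = g(v)·(t(v)⁻¹)ᵐ`. [folklore] -/
theorem awayEvalU_mk (v : Fin (n + 1) → S) (hv : IsUnit (aeval v t)) (ht : t ∈ 𝒜 d) {m : ℕ}
    (g : MvPolynomial (Fin (n + 1)) k) (hg : g ∈ 𝒜 (m • d)) :
    awayEvalU v hv (Away.mk 𝒜 ht m g hg) = aeval v g * (↑(hv.unit⁻¹) : S) ^ m := by
  rw [awayEvalU_apply, Away.val_mk, awayEvalULoc_mk]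

/-- Over a field the unit version is the field version `awayEval` of
`Motives/ProjectiveSpaceFieldPoints`. [folklore] -/
theorem awayEvalU_eq_awayEval {L : Type u} [Field L] [Algebra k L] (z : Fin (n + 1) → L)
    (hz : aeval z t ≠ 0) : awayEvalU z (isUnit_iff_ne_zero.mpr hz) = awayEval z hz :=
  rfl

/-- **Scaling invariance**: `awayEvalU (u • v) = awayEvalU v` for a unit `u`. [folklore] -/
theorem awayEvalU_smul (ht : t ∈ 𝒜 d) (v : Fin (n + 1) → S) (hv : IsUnit (aeval v t)) (u : Sˣ)
    (huv : IsUnit (aeval ((u : S) • v) t)) : awayEvalU (t := t) ((u : S) • v) huv = awayEvalU v hv := by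
  refine AlgHom.ext fun q => ?_
  obtain ⟨m, g, hg, rfl⟩ := Away.mk_surjective 𝒜 ht q
  rw [awayEvalU_mk _ _ ht, awayEvalU_mk _ _ ht]
  -- compare after multiplying by the unit `t(u • v)ᵐ = (uᵈ t(v))ᵐ`
  have htu : aeval ((u : S) • v) t = (u : S) ^ d * aeval v t :=
    isHomogeneous_aeval_const_mul ((mem_homogeneousSubmodule d t).mp ht) _ v
  have hgu : aeval ((u : S) • v) g = (u : S) ^ (m * d) * aeval v g := by
    have h := isHomogeneous_aeval_const_mul ((mem_homogeneousSubmodule _ g).mp hg) (u : S) v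
    rw [smul_eq_mul] at h
    exact h
  apply (huv.pow m).mul_right_cancel
  calc aeval ((u : S) • v) g * (↑(huv.unit⁻¹) : S) ^ m * aeval ((u : S) • v) t ^ m
      = aeval ((u : S) • v) g * ((↑(huv.unit⁻¹) : S) * aeval ((u : S) • v) t) ^ m := by ring
    _ = aeval ((u : S) • v) g := by rw [IsUnit.val_inv_mul, one_pow, mul_one]
    _ = (u : S) ^ (m * d) * aeval v g := hgu
    _ = ((u : S) ^ d) ^ m * (aeval v g * ((↑(hv.unit⁻¹) : S) * aeval v t) ^ m) := by
          rw [IsUnit.val_inv_mul, one_pow, mul_one, ← pow_mul, mul_comm d m]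
    _ = aeval v g * (↑(hv.unit⁻¹) : S) ^ m * ((u : S) ^ d * aeval v t) ^ m := by ring
    _ = aeval v g * (↑(hv.unit⁻¹) : S) ^ m * aeval ((u : S) • v) t ^ m := by rw [htu]

/-- Evaluating a homogeneous polynomial of degree `m` at `c • v` multiplies the value by `cᵐ` (any
commutative `k`-algebra). [folklore] -/
theorem aeval_smul_of_mem_ring {m : ℕ} {g : MvPolynomial (Fin (n + 1)) k} (hg : g ∈ 𝒜 m) (c : S)
    (v : Fin (n + 1) → S) : aeval (c • v) g = c ^ m * aeval v g :=
  isHomogeneous_aeval_const_mul ((mem_homogeneousSubmodule m g).mp hg) c v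

/-- Compatibility with enlarging the chart along `k[x]_{(t)} → k[x]_{(t t')}`. [folklore] -/
theorem awayEvalU_comp_awayMap {t' x : MvPolynomial (Fin (n + 1)) k} {d' : ℕ}
    (ht' : t' ∈ 𝒜 d') (hx : x = t * t') (v : Fin (n + 1) → S) (hv : IsUnit (aeval v t))
    (hxv : IsUnit (aeval v x)) :
    (awayEvalU v hxv).toRingHom.comp (awayMap 𝒜 ht' hx) = (awayEvalU (t := t) v hv).toRingHom := by
  refine RingHom.ext fun q => ?_
  change awayEvalULoc v hxv (awayMap 𝒜 ht' hx q).val = awayEvalULoc v hv q.val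
  rw [val_awayMap, ← RingHom.comp_apply]
  congr 1
  refine IsLocalization.ringHom_ext (Submonoid.powers t) (RingHom.ext fun a => ?_)
  simp only [RingHom.coe_comp, Function.comp_apply, Localization.awayLift,
    IsLocalization.Away.lift_eq]
  change awayEvalULoc v hxv (algebraMap _ _ a) = awayEvalULoc v hv (algebraMap _ _ a)
  rw [awayEvalULoc_algebraMap, awayEvalULoc_algebraMap]

/-- **Functoriality**: for a `k`-algebra map `ρ : S → S'`, `ρ ∘ awayEvalU v = awayEvalU (ρ ∘ v)`.
[folklore] -/
theorem algHom_comp_awayEvalU {S' : Type u} [CommRing S'] [Algebra k S'] (ρ : S →ₐ[k] S')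
    (ht : t ∈ 𝒜 d) (v : Fin (n + 1) → S) (hv : IsUnit (aeval v t))
    (hρv : IsUnit (aeval (fun j => ρ (v j)) t)) :
    ρ.comp (awayEvalU v hv) = awayEvalU (fun j => ρ (v j)) hρv := by
  refine AlgHom.ext fun q => ?_
  obtain ⟨m, g, hg, rfl⟩ := Away.mk_surjective 𝒜 ht q
  have hρ : ∀ p : MvPolynomial (Fin (n + 1)) k, ρ (aeval v p) = aeval (fun j => ρ (v j)) p :=
    fun p => by
      have h := DFunLike.congr_fun (MvPolynomial.comp_aeval (f := v) ρ) p
      simpa using h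
  rw [AlgHom.comp_apply, awayEvalU_mk _ _ ht, awayEvalU_mk _ _ ht, map_mul, map_pow, hρ]
  congr 2
  -- `ρ (t(v)⁻¹) = t(ρ v)⁻¹`
  apply hρv.mul_left_cancel
  rw [IsUnit.mul_val_inv, ← hρ, ← map_mul, IsUnit.mul_val_inv, map_one]

end AwayEvalU

/-! ### The morphism `Spec S → ℙⁿ_k` with homogeneous coordinates `v` -/

section VecChartPoint

variable {t : MvPolynomial (Fin (n + 1)) k} {d : ℕ}

/-- **The `k`-morphism `Spec S → ℙⁿ_k` with homogeneous coordinates `v ∈ Sⁿ⁺¹`**, built through the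
chart `D₊(t)` where `t(v)` is a unit: `Spec S → Spec k[x]_{(t)} = D₊(t) ⊆ ℙⁿ_k`
(Hartshorne II Thm. 7.1 for the generating sections `v₀, …, vₙ` of `𝒪_{Spec S}`; Görtz–Wedhorn I
(13.8)). [folklore] -/
def vecChartPoint (ht : t ∈ 𝒜 d) (hd : 0 < d) (v : Fin (n + 1) → S) (hv : IsUnit (aeval v t)) :
    specOver k S ⟶ projectiveSpace n k :=
  specOverOfAlgHom (awayEvalU v hv) ≫ awayChartι ht hd

/-- The underlying morphism of `vecChartPoint` is `Spec (awayEvalU v) ≫ awayι`. [folklore] -/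
theorem vecChartPoint_left (ht : t ∈ 𝒜 d) (hd : 0 < d) (v : Fin (n + 1) → S)
    (hv : IsUnit (aeval v t)) :
    (vecChartPoint ht hd v hv).left =
      Spec.map (CommRingCat.ofHom (awayEvalU v hv).toRingHom) ≫ Proj.awayι 𝒜 t ht hd :=
  rfl

/-- Over a field, `vecChartPoint` is the `chartPoint` of `Motives/ProjectiveSpaceFieldPoints`.
[folklore] -/
theorem vecChartPoint_eq_chartPoint {L : Type u} [Field L] [Algebra k L] (ht : t ∈ 𝒜 d) (hd : 0 < d)
    (z : Fin (n + 1) → L) (hz : aeval z t ≠ 0) :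
    vecChartPoint ht hd z (isUnit_iff_ne_zero.mpr hz) = chartPoint ht hd z hz :=
  rfl

/-- Independence of the chart, multiplicative form (through `D₊(t t')`, Mathlib
`Proj.SpecMap_awayMap_awayι`). [folklore] -/
theorem vecChartPoint_eq_vecChartPoint_mul (ht : t ∈ 𝒜 d) (hd : 0 < d)
    {t' x : MvPolynomial (Fin (n + 1)) k} {d' : ℕ} (ht' : t' ∈ 𝒜 d') (hx : x = t * t')
    (v : Fin (n + 1) → S) (hv : IsUnit (aeval v t)) (hv' : IsUnit (aeval v t')) :
    vecChartPoint ht hd v hv =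
      vecChartPoint (t := x) (hx ▸ SetLike.mul_mem_graded ht ht') (Nat.add_pos_left hd d') v
        (by rw [hx, map_mul]; exact hv.mul hv') := by
  ext : 1
  rw [vecChartPoint_left, vecChartPoint_left,
    ← Proj.SpecMap_awayMap_awayι 𝒜 ht hd ht' hx, ← Category.assoc, ← Spec.map_comp,
    ← CommRingCat.ofHom_comp, awayEvalU_comp_awayMap ht' hx v hv]

/-- **Independence of the chart**: the morphisms built through two charts `D₊(t)`, `D₊(t')` in which
`v` has unit values agree. [folklore] -/
theorem vecChartPoint_eq_vecChartPoint (ht : t ∈ 𝒜 d) (hd : 0 < d)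
    {t' : MvPolynomial (Fin (n + 1)) k} {d' : ℕ} (ht' : t' ∈ 𝒜 d') (hd' : 0 < d')
    (v : Fin (n + 1) → S) (hv : IsUnit (aeval v t)) (hv' : IsUnit (aeval v t')) :
    vecChartPoint ht hd v hv = vecChartPoint ht' hd' v hv' :=
  (vecChartPoint_eq_vecChartPoint_mul ht hd ht' rfl v hv hv').trans
    (vecChartPoint_eq_vecChartPoint_mul ht' hd' ht (mul_comm t t') v hv' hv).symm

/-- **Scaling invariance**: `[u • v] = [v]` for `u ∈ Sˣ`. [folklore] -/
theorem vecChartPoint_smul (ht : t ∈ 𝒜 d) (hd : 0 < d) (v : Fin (n + 1) → S)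
    (hv : IsUnit (aeval v t)) (u : Sˣ) (huv : IsUnit (aeval ((u : S) • v) t)) :
    vecChartPoint ht hd ((u : S) • v) huv = vecChartPoint ht hd v hv := by
  unfold vecChartPoint
  rw [awayEvalU_smul ht v hv u huv]

/-- **Functoriality in `S`**: for a `k`-algebra map `ρ : S → S'`,
`Spec ρ ≫ [v] = [ρ ∘ v]`. [folklore] -/
theorem specOverOfAlgHom_comp_vecChartPoint {S' : Type u} [CommRing S'] [Algebra k S'] (ρ : S →ₐ[k] S')
    (ht : t ∈ 𝒜 d) (hd : 0 < d) (v : Fin (n + 1) → S) (hv : IsUnit (aeval v t))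
    (hρv : IsUnit (aeval (fun j => ρ (v j)) t)) :
    specOverOfAlgHom ρ ≫ vecChartPoint ht hd v hv = vecChartPoint ht hd (fun j => ρ (v j)) hρv := by
  unfold vecChartPoint
  rw [← Category.assoc, ← specOverOfAlgHom_comp, algHom_comp_awayEvalU ρ ht v hv hρv]

/-- A `k`-algebra map applied to a vector with a unit value of `t` again has a unit value. [folklore] -/
theorem isUnit_aeval_comp {S' : Type u} [CommRing S'] [Algebra k S'] (ρ : S →ₐ[k] S')
    {v : Fin (n + 1) → S} (hv : IsUnit (aeval v t)) : IsUnit (aeval (fun j => ρ (v j)) t) := by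
  have h := DFunLike.congr_fun (MvPolynomial.comp_aeval (f := v) ρ) t
  simp only [AlgHom.coe_comp, Function.comp_apply] at h
  rw [← h]
  exact hv.map ρ

end VecChartPoint

end ProjectiveSpace

end Literature.AlgebraicGeometry.Motives
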